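import Mathlib
import HarnessLib
import Summits.Langlands.Langlands.Theorems.ExteriorSquareAscentInducedSquareAscentRegroup
import Summits.Langlands.Langlands.Theorems.ExteriorSquareAscentInducedSquareAscentIdentitiesAB
import Summits.Langlands.Langlands.Theorems.ExteriorSquareAscentInducedSquareAscentIdentityStar
import Summits.Langlands.Langlands.Theorems.ExteriorSquareAscentInducedSquareAscentStubCentralCharacterDescent
import Summits.Langlands.Langlands.Theorems.ExteriorSquareAscentInducedSquareAscentStubLocalIdentities
import Summits.Langlands.Langlands.Theorems.ExteriorSquareAscentInducedSquareAscentCoreAux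
import Literature.NumberTheory.Automorphic.IsobaricRigidityRepData
import Literature.NumberTheory.Automorphic.PairLFunctionPolesRepDataHolds
import Literature.NumberTheory.Automorphic.GaloisActionPlaces
import Literature.NumberTheory.Automorphic.KimExteriorSquareGL4Lemmas
import Literature.NumberTheory.Automorphic.KimExteriorSquareGL4Proofs
import Literature.NumberTheory.Automorphic.TunnellOctahedralGlobal
import Literature.NumberTheory.Automorphic.ArthurClozelCuspidalDescentGLOneHolds
import Literature.NumberTheory.Automorphic.AutomorphicTwistHecke
import Literature.NumberTheory.Automorphic.HeckeCharacterPairRigidity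
import Literature.NumberTheory.Automorphic.RamakrishnanMultiplicityOneDihedral
import Literature.NumberTheory.Automorphic.RamakrishnanMultiplicityOneLemma414
import Literature.NumberTheory.Automorphic.CuspidalDescentDetCubicRepData
import Literature.NumberTheory.Automorphic.ExistsClassFieldCharacterHolds
import Literature.NumberTheory.Automorphic.ClassFieldCharacterFrobenius
import Literature.NumberTheory.Automorphic.ArtinLFunctionsAbelianProofs
import Literature.NumberTheory.Automorphic.PairLFunctionPolesGLOneProofs
import Literature.NumberTheory.GaloisRepresentations.HeckeLFunctionAnalyticProofs
import Literature.NumberTheory.GaloisRepresentations.HeckeCharacter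

/-!
# The Klein cube pole (stub `stub_kleinCubePole` of crux `InducedSquareAscent`)

For unitary zero-free matching data `(π₀, P₀)`, a Galois-conjugate datum `P₀^τ`, a Hecke character `μ`
of `K` with `e₃(t_{P₀,w}) = μ(ϖ_v)^{f(w|v)}` a.e., and granted Arthur–Clozel Ch. 3 (2.2), (2.3) for
Borel–Jacquet data, `π₀` is essentially self-dual at Satake level by a Hecke character. Proof (Step D of
the idea card): the Klein cube identity (✦) of `…InducedSquareAscentIdentityStar` with `c := μ⁻¹`,
`L^S(π₀×π₀⊗ωμ⁻¹)·L^S(π₀^∨×π₀^∨⊗ω²μ⁻¹) = ζ_L^T·L^T(P₀^∨×P₀^τ)·L^T(P₀⊗(ωμ⁻¹)_L)²`; along `t ↦ 1 + t`,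
`t → 0⁺` the right side has `t^{1+e}·RHS → c ≠ 0`, so the two `GL₄×GL₄` pairs on the left cannot both be
off their `X` (Jacquet–Shalika (2.2)); `X` for `(π₀, π₀⊗ωμ⁻¹)` reads `t⁻¹ = (ωμ⁻¹)(ϖ_v)·t`, for
`(π₀^∨, π₀^∨⊗ω²μ⁻¹)` reads `t⁻¹ = (ω²μ⁻¹)⁻¹(ϖ_v)·t`.
-/

set_option linter.unusedVariables false
set_option linter.dupNamespace false
set_option linter.unusedSimpArgs false

noncomputable section

namespace Summit.Langlands.Langlands.Theorems.InducedSquareAscentKleinCube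

open scoped Classical NumberField Topology
open Filter IsDedekindDomain NumberField
open Literature.NumberTheory.Automorphic
open Literature.NumberTheory.GaloisRepresentations (HeckeCharacter)

/-! ### The stub -/

set_option maxHeartbeats 800000 in
/-- **STUB 7 of the Klein-cube line — the Klein cube pole (Step D of the idea card: identity (✦) +
Jacquet–Shalika (2.2)/(2.3)).** See the module docstring for the statement and the proof. Inputs: the
landed `stub_localIdentities` (local identities (5), (6)), `kleinHelper_identityStar`, the fibre
lemmas of `kleinHelper_regroup`, and the tree's theorems: unitary (2.1)
(`JacquetShalika1981_multipliable_partialPairL_repData_holds`), the limit packaging of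
`IsobaricRigidityRepData`, central characters, base change of Hecke characters, contragredients,
twists, `GL(1)` data. [cite: JacquetShalikaAJM1981II, Prop. 3.6 and Thm. 4.4]
[cite: ArthurClozelAMS120, Ch. 3 §2 (2.1)–(2.3) and Lemma 4.3] -/
theorem stub_kleinCubePole :
    ∀ (K L : Type) [Field K] [NumberField K] [Field L] [NumberField L] [Algebra K L] [IsGalois K L],
      Module.finrank K L = 2 → ∀ (τ : L ≃ₐ[K] L), τ ≠ 1 →
      ∀ (hcpt : isCompact_glFiniteIntegralLevel 4 K) (hL3 : isCompact_glFiniteIntegralLevel 3 L)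
        (π₀ : CuspidalAutomorphicRepData 4 K hcpt) (P₀ : CuspidalAutomorphicRepData 3 L hL3),
      JacquetShalika1981_partialPairL_boundary_repData →
      JacquetShalika1981_partialPairL_pole_repData →
      (∀ᶠ v : HeightOneSpectrum (𝓞 K) in cofinite, ∀ α : Multiset ℂ, π₀.1.HasSatakeParamAt v α →
        ‖α.prod‖ = 1 ∧ ∀ a ∈ α, a ≠ 0) →
      (∀ᶠ w : HeightOneSpectrum (𝓞 L) in cofinite, ∀ β : Multiset ℂ, P₀.1.HasSatakeParamAt w β →
        ‖β.prod‖ = 1 ∧ ∀ b ∈ β, b ≠ 0) →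
      (∀ᶠ v : HeightOneSpectrum (𝓞 K) in cofinite, ∀ α : Multiset ℂ, π₀.1.HasSatakeParamAt v α →
        ((∃ w : HeightOneSpectrum (𝓞 L), w.asIdeal.under (𝓞 K) = v.asIdeal ∧
            w.asIdeal.inertiaDeg (𝓞 K) = 1) →
          ∃ w₁ w₂ : HeightOneSpectrum (𝓞 L), w₁ ≠ w₂ ∧ w₁.asIdeal.under (𝓞 K) = v.asIdeal ∧
            w₂.asIdeal.under (𝓞 K) = v.asIdeal ∧ ∃ β₁ β₂ : Multiset ℂ,
              P₀.1.HasSatakeParamAt w₁ β₁ ∧ P₀.1.HasSatakeParamAt w₂ β₂ ∧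
                (α.powersetCard 2).map Multiset.prod = β₁ + β₂) ∧
        ((¬ ∃ w : HeightOneSpectrum (𝓞 L), w.asIdeal.under (𝓞 K) = v.asIdeal ∧
            w.asIdeal.inertiaDeg (𝓞 K) = 1) →
          ∃ w : HeightOneSpectrum (𝓞 L), w.asIdeal.under (𝓞 K) = v.asIdeal ∧
            ∃ β γ : Multiset ℂ, P₀.1.HasSatakeParamAt w β ∧ γ.map (fun c => c ^ 2) = β ∧
              (α.powersetCard 2).map Multiset.prod = γ + γ.map (fun c => -c))) →
      (∃ P' : CuspidalAutomorphicRepData 3 L hL3, ∀ᶠ w : HeightOneSpectrum (𝓞 L) in cofinite,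
        ∀ β : Multiset ℂ, P'.1.HasSatakeParamAt w β ↔ P₀.1.HasSatakeParamAt (τ • w) β) →
      ∀ (μ : HeckeCharacter K),
      (∀ᶠ w : HeightOneSpectrum (𝓞 L) in cofinite, ∀ β : Multiset ℂ, P₀.1.HasSatakeParamAt w β →
          β.prod = μ.valueAtUniformizer (w.under (𝓞 K)) ^ w.asIdeal.inertiaDeg (𝓞 K)) →
      ∃ χ : HeckeCharacter K, ∀ᶠ v : HeightOneSpectrum (𝓞 K) in cofinite, ∀ α : Multiset ℂ,
        π₀.1.HasSatakeParamAt v α →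
          α.map (fun a => a⁻¹) = α.map (fun a => χ.valueAtUniformizer v * a)  := by
  intro K L _ _ _ _ _ _ hdeg τ hτ hcpt hL3 π₀ P₀ h22 h23 hUπ hUP hmatch hgal μ hμ
  classical
  /- ## 0. Generalities -/
  have h1K : isCompact_glFiniteIntegralLevel 1 K := isCompact_glFiniteIntegralLevel_holds 1 K
  have h1L : isCompact_glFiniteIntegralLevel 1 L := isCompact_glFiniteIntegralLevel_holds 1 L
  haveI : FiniteDimensional K L := Module.finite_of_finrank_pos (by omega)
  have huπ : π₀.1.hasSatakeParamAt_unique := π₀.1.hasSatakeParamAt_unique_holds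
  have huP : P₀.1.hasSatakeParamAt_unique := P₀.1.hasSatakeParamAt_unique_holds
  /- ## 1. Satake families, characters, auxiliary data -/
  obtain ⟨α, hα⟩ := kc_exists_satakeFamily π₀.1
  obtain ⟨B, hB⟩ := kc_exists_satakeFamily P₀.1
  obtain ⟨ω, hω⟩ := exists_heckeCharacter_prod_satake' π₀
  obtain ⟨Ω, hΩ⟩ := exists_heckeCharacter_prod_satake' P₀
  set ωL : HeckeCharacter L := ω.baseChange L with hωLdef
  have hωL := ω.eventually_valueAtUniformizer_baseChange (E := L)
  set cL : HeckeCharacter L := (μ⁻¹).baseChange L with hcLdef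
  have hcL := (μ⁻¹).eventually_valueAtUniformizer_baseChange (E := L)
  set χ₁ : HeckeCharacter K := ω * μ⁻¹ with hχ₁
  set χ₂ : HeckeCharacter K := ω * ω * μ⁻¹ with hχ₂
  set ξ : HeckeCharacter L := Ω * cL with hξ
  obtain ⟨πv, hπv⟩ := CuspidalAutomorphicRepData.exists_contragredient_satake_holds hcpt π₀
  obtain ⟨T1, hT1⟩ := π₀.exists_twist_hecke_hasSatakeParamAt χ₁
  obtain ⟨T2, hT2⟩ := πv.exists_twist_hecke_hasSatakeParamAt χ₂
  obtain ⟨P', hP'⟩ := hgal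
  obtain ⟨Pv, hPv⟩ := CuspidalAutomorphicRepData.exists_contragredient_satake_holds hL3 P₀
  obtain ⟨Tτ, hTτ⟩ := P'.exists_twist_hecke_hasSatakeParamAt ξ
  obtain ⟨T3, hT3⟩ := P₀.exists_twist_hecke_hasSatakeParamAt (ωL * cL)
  obtain ⟨oneL, honeL⟩ := exists_cuspidal_glOne_hasSatakeParamAt_one h1L
  /- ## 2. The good places -/
  have hGK : ∀ᶠ v : HeightOneSpectrum (𝓞 K) in cofinite, π₀.1.HasSatakeParamAt v (α v) ∧ (∀ a : Multiset ℂ, π₀.1.HasSatakeParamAt v a → ‖a.prod‖ = 1 ∧ ∀ x ∈ a, x ≠ 0) ∧ (∀ a : Multiset ℂ, π₀.1.HasSatakeParamAt v a → ((∃ w : HeightOneSpectrum (𝓞 L), w.asIdeal.under (𝓞 K) = v.asIdeal ∧ w.asIdeal.inertiaDeg (𝓞 K) = 1) → ∃ w₁ w₂ : HeightOneSpectrum (𝓞 L), w₁ ≠ w₂ ∧ w₁.asIdeal.under (𝓞 K) = v.asIdeal ∧ w₂.asIdeal.under (𝓞 K) = v.asIdeal ∧ ∃ β₁ β₂ : Multiset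 ℂ, P₀.1.HasSatakeParamAt w₁ β₁ ∧ P₀.1.HasSatakeParamAt w₂ β₂ ∧ (a.powersetCard 2).map Multiset.prod = β₁ + β₂) ∧ ((¬ ∃ w : HeightOneSpectrum (𝓞 L), w.asIdeal.under (𝓞 K) = v.asIdeal ∧ w.asIdeal.inertiaDeg (𝓞 K) = 1) → ∃ w : HeightOneSpectrum (𝓞 L), w.asIdeal.under (𝓞 K) = v.asIdeal ∧ ∃ β γ : Multiset ℂ, P₀.1.HasSatakeParamAt w β ∧ γ.map (fun c => c ^ 2) = β ∧ (a.powersetCard 2).map Multiset.prod = γ + γ.map (fun c => -c))) ∧ (∀ a : Multiset ℂ, π₀.1.HasSatakeParamAt v a → ω.valueAtUniformizer v = a.prod) ∧ (∀ a : Multiset ℂ, π₀.1.HasSatakeParamAt v a → T1.1.HasSatakeParamAt v (a.map (χ₁.valueAtUniformizer v * ·))) ∧ (∀ a : Multiset ℂ, πv.1.HasSatakeParamAt v a → T2.1.HasSatakeParamAt v (a.map (χ₂.valueAtUniformizer v * ·))) ∧ v.asIdeal.ramificationIdxIn (𝓞 L) = 1 := by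
    filter_upwards [hα, hUπ, hmatch, hω, hT1, hT2,
      eventually_ramificationIdxIn_eq_one (K := K) (L := L)] with v h1 h2 h3 h4 h5 h6 h7
    exact ⟨h1, h2, h3, h4, h5, h6, h7⟩
  have hGL : ∀ᶠ w : HeightOneSpectrum (𝓞 L) in cofinite, P₀.1.HasSatakeParamAt w (B w) ∧ (∀ b : Multiset ℂ, P₀.1.HasSatakeParamAt w b → ‖b.prod‖ = 1 ∧ ∀ x ∈ b, x ≠ 0) ∧ (∀ b : Multiset ℂ, P₀.1.HasSatakeParamAt w b → Ω.valueAtUniformizer w = b.prod) ∧ ωL.valueAtUniformizer w = ω.valueAtUniformizer (w.under (𝓞 K)) ^ w.asIdeal.inertiaDeg (𝓞 K) ∧ cL.valueAtUniformizer w = (μ⁻¹).valueAtUniformizer (w.under (𝓞 K)) ^ w.asIdeal.inertiaDeg (𝓞 K) ∧ (∀ b : Multiset ℂ, P₀.1.HasSatakeParamAt w b → b.prod = μ.valueAtUniformizer (w.under (𝓞 K)) ^ w.asIdeal.inertiaDeg (𝓞 K)) ∧ (∀ b : Multiset ℂ, P'.1.HasSatakeParamAt w b ↔ P₀.1.HasSatakeParamAt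 (τ • w) b) ∧ (∀ b : Multiset ℂ, P'.1.HasSatakeParamAt w b → Tτ.1.HasSatakeParamAt w (b.map (ξ.valueAtUniformizer w * ·))) ∧ (∀ b : Multiset ℂ, P₀.1.HasSatakeParamAt w b → T3.1.HasSatakeParamAt w (b.map ((ωL * cL).valueAtUniformizer w * ·))) ∧ oneL.1.HasSatakeParamAt w {1} := by
    filter_upwards [hB, hUP, hΩ, hωL, hcL, hμ, hP', hTτ, hT3, honeL] with w h1 h2 h3 h4 h5 h6 h7 h8 h9 h10
    exact ⟨h1, h2, h3, h4, h5, h6, h7, h8, h9, h10⟩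
  have hGL' := ccd_eventually_forall_under_eq_under K hGL
  have hGKL := Literature.NumberTheory.Automorphic.eventually_under (F := K) (E := L) hGK
  have hGLK := eventually_forall_under_eq (F := K) (E := L) hGL
  /- ## 3. The Jacquet–Shalika sets -/
  obtain ⟨S1, hS1f, hk1⟩ := h22 4 4 K hcpt hcpt (by norm_num) (by norm_num) π₀ T1
  obtain ⟨S2, hS2f, hk2⟩ := h22 4 4 K hcpt hcpt (by norm_num) (by norm_num) πv T2
  obtain ⟨Tξ0, hTξ0f, hlξ⟩ :=
    exists_tendsto_ofReal_mul_partialPairL_dual h23 (by norm_num : 0 < 1) oneL oneL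
  obtain ⟨Tτ0, hTτ0f, hlτ⟩ := exists_tendsto_pow_mul_partialPairL_ofReal_add h22 h23 (by norm_num : 0 < 3) (by norm_num : 0 < 3) Pv Tτ
  obtain ⟨T30, hT30f, hl3⟩ := exists_tendsto_pow_mul_partialPairL_ofReal_add h22 h23 (by norm_num : 0 < 3) (by norm_num : 0 < 1) T3 oneL
  obtain ⟨M1, hM1f, hm1⟩ := JacquetShalika1981_multipliable_partialPairL_repData_holds 4 4 K hcpt hcpt (by norm_num) (by norm_num) π₀ T1
  obtain ⟨M2, hM2f, hm2⟩ := JacquetShalika1981_multipliable_partialPairL_repData_holds 4 4 K hcpt hcpt (by norm_num) (by norm_num) πv T2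
  obtain ⟨M3, hM3f, hm3⟩ := JacquetShalika1981_multipliable_partialPairL_repData_holds 1 1 L h1L h1L (by norm_num) (by norm_num) oneL oneL
  obtain ⟨M4, hM4f, hm4⟩ := JacquetShalika1981_multipliable_partialPairL_repData_holds 3 3 L hL3 hL3 (by norm_num) (by norm_num) Pv Tτ
  obtain ⟨M5, hM5f, hm5⟩ := JacquetShalika1981_multipliable_partialPairL_repData_holds 3 1 L hL3 h1L (by norm_num) (by norm_num) T3 oneL
  /- ## 4. The exceptional set `S` and the set `T` of places of `L` above it -/
  obtain ⟨SK, hSKf, hSK⟩ := kc_exists_finite_forall_not_mem hGK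
  obtain ⟨SL, hSLf, hSL⟩ := kc_exists_finite_forall_not_mem hGL'
  obtain ⟨SKL, hSKLf, hSKL⟩ := kc_exists_finite_forall_not_mem hGLK
  set uK : HeightOneSpectrum (𝓞 L) → HeightOneSpectrum (𝓞 K) := fun w => w.under (𝓞 K) with huK
  set SJL : Set (HeightOneSpectrum (𝓞 L)) := Tξ0 ∪ Tτ0 ∪ T30 ∪ M3 ∪ M4 ∪ M5 with hSJL
  have hSJLf : SJL.Finite := ((((hTξ0f.union hTτ0f).union hT30f).union hM3f).union hM4f).union hM5f
  set S : Set (HeightOneSpectrum (𝓞 K)) :=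
    SK ∪ uK '' SL ∪ SKL ∪ (S1 ∪ S2 ∪ M1 ∪ M2) ∪ uK '' SJL with hSdef
  have hSf : S.Finite :=
    ((((hSKf.union (hSLf.image _)).union hSKLf).union
      (((hS1f.union hS2f).union hM1f).union hM2f))).union (hSJLf.image _)
  set T : Set (HeightOneSpectrum (𝓞 L)) := {w | w.under (𝓞 K) ∈ S} with hTdef
  have hTf : T.Finite := finite_setOf_under_mem hSf
  have hS1 : S1 ⊆ S := fun v hv => by simp only [hSdef, Set.mem_union, hv, true_or, or_true]
  have hS2 : S2 ⊆ S := fun v hv => by simp only [hSdef, Set.mem_union, hv, true_or, or_true]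
  have hM1 : M1 ⊆ S := fun v hv => by simp only [hSdef, Set.mem_union, hv, true_or, or_true]
  have hM2 : M2 ⊆ S := fun v hv => by simp only [hSdef, Set.mem_union, hv, true_or, or_true]
  have hTsub : ∀ X : Set (HeightOneSpectrum (𝓞 L)), X ⊆ SJL → X ⊆ T := by
    intro X hX w hw
    simp only [hTdef, Set.mem_setOf_eq, hSdef, Set.mem_union, Set.mem_image]
    exact Or.inr ⟨w, hX hw, rfl⟩
  have hTξ0 : Tξ0 ⊆ T := hTsub _ (fun w hw => by simp only [hSJL, Set.mem_union, hw, true_or, or_true])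
  have hTτ0 : Tτ0 ⊆ T := hTsub _ (fun w hw => by simp only [hSJL, Set.mem_union, hw, true_or, or_true])
  have hT30 : T30 ⊆ T := hTsub _ (fun w hw => by simp only [hSJL, Set.mem_union, hw, true_or, or_true])
  have hM3 : M3 ⊆ T := hTsub _ (fun w hw => by simp only [hSJL, Set.mem_union, hw, true_or, or_true])
  have hM4 : M4 ⊆ T := hTsub _ (fun w hw => by simp only [hSJL, Set.mem_union, hw, true_or, or_true])
  have hM5 : M5 ⊆ T := hTsub _ (fun w hw => by simp only [hSJL, Set.mem_union, hw, true_or, or_true])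
  have hK : ∀ v ∉ S, _ := fun v hv => hSK v (fun h => hv (by simp only [hSdef, Set.mem_union, h, true_or]))
  have hKL : ∀ v ∉ S, _ := fun v hv => hSKL v (fun h => hv (by simp only [hSdef, Set.mem_union, h, true_or, or_true]))
  have hL : ∀ w : HeightOneSpectrum (𝓞 L), w.under (𝓞 K) ∉ S → ∀ u : HeightOneSpectrum (𝓞 L), u.under (𝓞 K) = w.under (𝓞 K) → _ := fun w hw => hSL w (fun h => hw (by
      simp only [hSdef, Set.mem_union, Set.mem_image]
      exact Or.inl (Or.inl (Or.inl (Or.inr ⟨w, h, rfl⟩)))))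
  /- ## 5. Pointwise facts at the good places -/
  have sα : ∀ v ∉ S, π₀.1.HasSatakeParamAt v (α v) := fun v hv => (hK v hv).1
  have uα : ∀ v ∉ S, ‖(α v).prod‖ = 1 := fun v hv => ((hK v hv).2.1 (α v) (sα v hv)).1
  have nzα : ∀ v ∉ S, ∀ x ∈ α v, x ≠ 0 := fun v hv => ((hK v hv).2.1 (α v) (sα v hv)).2
  have cα : ∀ v ∉ S, Multiset.card (α v) = 4 := fun v hv => (sα v hv).card_eq
  have hωv : ∀ v ∉ S, ω.valueAtUniformizer v = (α v).prod := fun v hv => (hK v hv).2.2.2.1 (α v) (sα v hv)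
  have hunr : ∀ v ∉ S, v.asIdeal.ramificationIdxIn (𝓞 L) = 1 := fun v hv => (hK v hv).2.2.2.2.2.2
  -- `|μ(ϖ_v)| = 1` off `S` (read at a place of `L` above `v`)
  have nμ : ∀ v ∉ S, ‖μ.valueAtUniformizer v‖ = 1 := by
    intro v hv
    obtain ⟨w, hw⟩ := kc_exists_place_over (L := L) v
    have hgl := hKL v hv w (by rw [← hw]; rfl)
    have hb := hgl.2.2.2.2.2.1 (B w) hgl.1
    have hn : ‖(B w).prod‖ = 1 := (hgl.2.1 (B w) hgl.1).1
    rw [hb, norm_pow, hw] at hn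
    have hf : w.asIdeal.inertiaDeg (𝓞 K) ≠ 0 := by
      rcases inertiaDeg_eq_one_or_two_of_finrank_eq_two hdeg v w (by rw [← hw]; rfl) with h | h <;> omega
    exact (pow_eq_one_iff_of_nonneg (norm_nonneg _) hf).mp hn
  have nzμ : ∀ v : HeightOneSpectrum (𝓞 K), μ.valueAtUniformizer v ≠ 0 := fun v => Units.ne_zero _
  -- values of the auxiliary characters
  set cK : HeightOneSpectrum (𝓞 K) → ℂ := fun v => (μ.valueAtUniformizer v)⁻¹ with hcK
  have hμinv : ∀ v : HeightOneSpectrum (𝓞 K), (μ⁻¹).valueAtUniformizer v = cK v := fun v => HeckeCharacter.valueAtUniformizer_inv μ v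
  have hχ₁v : ∀ v ∉ S, χ₁.valueAtUniformizer v = (α v).prod * cK v := fun v hv => by
    rw [hχ₁, HeckeCharacter.valueAtUniformizer_mul, hωv v hv, hμinv]
  have hχ₂v : ∀ v ∉ S, χ₂.valueAtUniformizer v = (α v).prod ^ 2 * cK v := fun v hv => by
    rw [hχ₂, HeckeCharacter.valueAtUniformizer_mul, HeckeCharacter.valueAtUniformizer_mul, hωv v hv,
      hμinv, sq]
  have ncK : ∀ v ∉ S, ‖cK v‖ = 1 := fun v hv => by rw [hcK]; simp only [norm_inv, nμ v hv, inv_one]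
  -- the `K`-side families
  set αv : SatakeFamily K := fun v => (α v).map (·⁻¹) with hαv
  set fT1 : SatakeFamily K := fun v => (α v).map (((α v).prod * cK v) * ·) with hfT1
  set fT2 : SatakeFamily K := fun v => ((α v).map (·⁻¹)).map (((α v).prod ^ 2 * cK v) * ·) with hfT2
  have sαv : ∀ v ∉ S, πv.1.HasSatakeParamAt v (αv v) := fun v hv => hπv v _ (sα v hv)
  have sT1 : ∀ v ∉ S, T1.1.HasSatakeParamAt v (fT1 v) := fun v hv => by
    have h := (hK v hv).2.2.2.2.1 _ (sα v hv)
    rwa [hχ₁v v hv] at h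
  have sT2 : ∀ v ∉ S, T2.1.HasSatakeParamAt v (fT2 v) := fun v hv => by
    have h := (hK v hv).2.2.2.2.2.1 _ (sαv v hv)
    rwa [hχ₂v v hv] at h
  have uαv : ∀ v ∉ S, ‖(αv v).prod‖ = 1 := fun v hv => by
    simp only [hαv, Multiset.prod_map_inv', norm_inv, uα v hv, inv_one]
  have uT1 : ∀ v ∉ S, ‖(fT1 v).prod‖ = 1 := fun v hv => by
    simp only [hfT1, kc_prod_map_const_mul, norm_mul, norm_pow, uα v hv, ncK v hv, one_pow, mul_one]
  have uT2 : ∀ v ∉ S, ‖(fT2 v).prod‖ = 1 := fun v hv => by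
    simp only [hfT2, kc_prod_map_const_mul, Multiset.prod_map_inv', norm_mul, norm_pow, norm_inv,
      uα v hv, ncK v hv, one_pow, inv_one, mul_one]
  -- `L`-side
  have hLw : ∀ w : HeightOneSpectrum (𝓞 L), w.under (𝓞 K) ∉ S → _ := fun w hw => hL w hw w rfl
  have hτunder : ∀ w : HeightOneSpectrum (𝓞 L), (τ • w).under (𝓞 K) = w.under (𝓞 K) := fun w => HeightOneSpectrum.under_algEquiv_smul K L τ w
  have hLτw : ∀ w : HeightOneSpectrum (𝓞 L), w.under (𝓞 K) ∉ S → _ := fun w hw => hL w hw (τ • w) (hτunder w)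
  have sB : ∀ w : HeightOneSpectrum (𝓞 L), w.under (𝓞 K) ∉ S → P₀.1.HasSatakeParamAt w (B w) := fun w hw => (hLw w hw).1
  have sBτ : ∀ w : HeightOneSpectrum (𝓞 L), w.under (𝓞 K) ∉ S → P₀.1.HasSatakeParamAt (τ • w) (B (τ • w)) := fun w hw => (hLτw w hw).1
  have uB : ∀ w : HeightOneSpectrum (𝓞 L), w.under (𝓞 K) ∉ S → ‖(B w).prod‖ = 1 := fun w hw => ((hLw w hw).2.1 _ (sB w hw)).1
  have uBτ : ∀ w : HeightOneSpectrum (𝓞 L), w.under (𝓞 K) ∉ S → ‖(B (τ • w)).prod‖ = 1 := fun w hw => ((hLτw w hw).2.1 _ (sBτ w hw)).1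
  have nzB : ∀ w : HeightOneSpectrum (𝓞 L), w.under (𝓞 K) ∉ S → ∀ x ∈ B w, x ≠ 0 := fun w hw => ((hLw w hw).2.1 _ (sB w hw)).2
  have cB : ∀ w : HeightOneSpectrum (𝓞 L), w.under (𝓞 K) ∉ S → Multiset.card (B w) = 3 := fun w hw => (sB w hw).card_eq
  have hΩw : ∀ w : HeightOneSpectrum (𝓞 L), w.under (𝓞 K) ∉ S → Ω.valueAtUniformizer w = (B w).prod := fun w hw => (hLw w hw).2.2.1 _ (sB w hw)
  have hωLw : ∀ w : HeightOneSpectrum (𝓞 L), w.under (𝓞 K) ∉ S → ωL.valueAtUniformizer w = (α (w.under (𝓞 K))).prod ^ w.asIdeal.inertiaDeg (𝓞 K) := fun w hw => by rw [(hLw w hw).2.2.2.1, hωv _ hw]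
  have hcLw : ∀ w : HeightOneSpectrum (𝓞 L), w.under (𝓞 K) ∉ S → cL.valueAtUniformizer w = (cK (w.under (𝓞 K))) ^ w.asIdeal.inertiaDeg (𝓞 K) := fun w hw => by rw [(hLw w hw).2.2.2.2.1, hμinv]
  have hμw : ∀ w : HeightOneSpectrum (𝓞 L), w.under (𝓞 K) ∉ S → (B w).prod = μ.valueAtUniformizer (w.under (𝓞 K)) ^ w.asIdeal.inertiaDeg (𝓞 K) := fun w hw => (hLw w hw).2.2.2.2.2.1 _ (sB w hw)
  have hξ1 : ∀ w : HeightOneSpectrum (𝓞 L), w.under (𝓞 K) ∉ S → Ω.valueAtUniformizer w * cL.valueAtUniformizer w = 1 := fun w hw => by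
    rw [hΩw w hw, hcLw w hw, hμw w hw, hcK]
    simp only [inv_pow]
    exact mul_inv_cancel₀ (pow_ne_zero _ (nzμ _))
  have nωL : ∀ w : HeightOneSpectrum (𝓞 L), w.under (𝓞 K) ∉ S → ‖ωL.valueAtUniformizer w‖ = 1 := fun w hw => by rw [hωLw w hw, norm_pow, uα _ hw, one_pow]
  have ncL : ∀ w : HeightOneSpectrum (𝓞 L), w.under (𝓞 K) ∉ S → ‖cL.valueAtUniformizer w‖ = 1 := fun w hw => by rw [hcLw w hw, norm_pow, ncK _ hw, one_pow]
  have nΩ : ∀ w : HeightOneSpectrum (𝓞 L), w.under (𝓞 K) ∉ S → ‖Ω.valueAtUniformizer w‖ = 1 := fun w hw => by rw [hΩw w hw, uB w hw]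
  have sP' : ∀ w : HeightOneSpectrum (𝓞 L), w.under (𝓞 K) ∉ S → P'.1.HasSatakeParamAt w (B (τ • w)) := fun w hw => ((hLw w hw).2.2.2.2.2.2.1 _).mpr (sBτ w hw)
  -- the `L`-side families
  set fξ : SatakeFamily L := fun w =>
    ({Ω.valueAtUniformizer w * cL.valueAtUniformizer w} : Multiset ℂ) with hfξ
  set oneL1 : SatakeFamily L := fun _ => ({1} : Multiset ℂ) with honeL1
  set fPv : SatakeFamily L := fun w => (B w).map (·⁻¹) with hfPv
  set fTτ : SatakeFamily L := fun w =>
    (B (τ • w)).map ((Ω.valueAtUniformizer w * cL.valueAtUniformizer w) * ·) with hfTτ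
  set fT3 : SatakeFamily L := fun w =>
    (B w).map ((ωL.valueAtUniformizer w * cL.valueAtUniformizer w) * ·) with hfT3
  have hξv : ∀ w : HeightOneSpectrum (𝓞 L), ξ.valueAtUniformizer w = Ω.valueAtUniformizer w * cL.valueAtUniformizer w := fun w => by rw [hξ, HeckeCharacter.valueAtUniformizer_mul]
  have hωcv : ∀ w : HeightOneSpectrum (𝓞 L), (ωL * cL).valueAtUniformizer w = ωL.valueAtUniformizer w * cL.valueAtUniformizer w := fun w => by rw [HeckeCharacter.valueAtUniformizer_mul]
  have s1L : ∀ w ∉ T, oneL.1.HasSatakeParamAt w (oneL1 w) := fun w hw => (hLw w hw).2.2.2.2.2.2.2.2.2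
  have sξ : ∀ w ∉ T, oneL.1.HasSatakeParamAt w (fξ w) := fun w hw => by
    have h1 : fξ w = {1} := by simp only [hfξ, hξ1 w hw]
    rw [h1]; exact (hLw w hw).2.2.2.2.2.2.2.2.2
  have sPv : ∀ w ∉ T, Pv.1.HasSatakeParamAt w (fPv w) := fun w hw => hPv w _ (sB w hw)
  have sTτ : ∀ w ∉ T, Tτ.1.HasSatakeParamAt w (fTτ w) := fun w hw => by
    have h := (hLw w hw).2.2.2.2.2.2.2.1 _ (sP' w hw)
    rwa [hξv] at h
  have sT3 : ∀ w ∉ T, T3.1.HasSatakeParamAt w (fT3 w) := fun w hw => by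
    have h := (hLw w hw).2.2.2.2.2.2.2.2.1 _ (sB w hw)
    rwa [hωcv] at h
  have uξ : ∀ w ∉ T, ‖(fξ w).prod‖ = 1 := fun w hw => by
    simp only [hfξ, Multiset.prod_singleton, hξ1 w hw, norm_one]
  have u1L : ∀ w ∉ T, ‖(oneL1 w).prod‖ = 1 := fun w hw => by simp [honeL1]
  have uPv : ∀ w ∉ T, ‖(fPv w).prod‖ = 1 := fun w hw => by
    simp only [hfPv, Multiset.prod_map_inv', norm_inv, uB w hw, inv_one]
  have uTτ : ∀ w ∉ T, ‖(fTτ w).prod‖ = 1 := fun w hw => by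
    simp only [hfTτ, kc_prod_map_const_mul, hξ1 w hw, one_pow, one_mul, uBτ w hw, Multiset.map_id']
  have uT3 : ∀ w ∉ T, ‖(fT3 w).prod‖ = 1 := fun w hw => by
    simp only [hfT3, kc_prod_map_const_mul, norm_mul, norm_pow, nωL w hw, ncL w hw, uB w hw, one_pow,
      mul_one]
  /- ## 6. The two candidate poles on the `K`-side -/
  by_cases hX1 : (4 = 4 ∧ ∀ᶠ v : HeightOneSpectrum (𝓞 K) in cofinite,
      (α v).map ((((v.residueCard : ℂ) ^ (1 - (1 : ℂ)))) * ·) = (fT1 v).map (·⁻¹))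
  · refine ⟨χ₁, ?_⟩
    filter_upwards [hX1.2, hGK] with v hx hgk
    intro a ha
    have haA : a = α v := huπ ha hgk.1
    have hk : χ₁.valueAtUniformizer v = (α v).prod * cK v := by
      rw [hχ₁, HeckeCharacter.valueAtUniformizer_mul, hgk.2.2.2.1 (α v) hgk.1, hμinv]
    have hx' : α v = ((α v).map (((α v).prod * cK v) * ·)).map (·⁻¹) := by
      simpa only [sub_self, Complex.cpow_zero, one_mul, Multiset.map_id', hfT1] using hx
    rw [haA, hk]
    conv_lhs => rw [hx']
    simp only [Multiset.map_map, Function.comp_def, inv_inv]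
  by_cases hX2 : (4 = 4 ∧ ∀ᶠ v : HeightOneSpectrum (𝓞 K) in cofinite,
      (αv v).map ((((v.residueCard : ℂ) ^ (1 - (1 : ℂ)))) * ·) = (fT2 v).map (·⁻¹))
  · refine ⟨χ₂⁻¹, ?_⟩
    filter_upwards [hX2.2, hGK] with v hx hgk
    intro a ha
    have haA : a = α v := huπ ha hgk.1
    have hk : (χ₂⁻¹).valueAtUniformizer v = ((α v).prod ^ 2 * cK v)⁻¹ := by
      rw [HeckeCharacter.valueAtUniformizer_inv, hχ₂, HeckeCharacter.valueAtUniformizer_mul,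
        HeckeCharacter.valueAtUniformizer_mul, hgk.2.2.2.1 (α v) hgk.1, hμinv, sq]
    have hx' : (α v).map (·⁻¹) = (((α v).map (·⁻¹)).map (((α v).prod ^ 2 * cK v) * ·)).map (·⁻¹) := by
      simpa only [sub_self, Complex.cpow_zero, one_mul, Multiset.map_id', hfT2, hαv] using hx
    rw [haA, hk, hx']
    simp only [Multiset.map_map, Function.comp_def, mul_inv, inv_inv]
  exfalso
  /- ## 7. Limits as `t → 0⁺` along `s = 1 + t` -/
  have hz1 : (1 : ℝ) ≤ (1 : ℂ).re := by simp
  obtain ⟨ca, hca, Ta'⟩ := hk1 hSf hS1 sα sT1 uα uT1 Complex.one_re hX1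
  have Ta : Tendsto (fun t : ℝ => partialPairL S α fT1 (1 + t)) (𝓝[>] (0 : ℝ)) (𝓝 ca) :=
    Ta'.comp (tendsto_ofReal_add_nhdsWithin hz1)
  obtain ⟨cb, hcb, Tb'⟩ := hk2 hSf hS2 sαv sT2 uαv uT2 Complex.one_re hX2
  have Tb : Tendsto (fun t : ℝ => partialPairL S αv fT2 (1 + t)) (𝓝[>] (0 : ℝ)) (𝓝 cb) :=
    Tb'.comp (tendsto_ofReal_add_nhdsWithin hz1)
  obtain ⟨cξ, hcξ, Tξ⟩ := hlξ hTf hTξ0 sξ s1L uξ u1L (fun w hw => by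
    simp only [honeL1, hfξ, hξ1 w hw, Multiset.map_singleton, inv_one])
  obtain ⟨eτ, cτ, hcτ, -, Tτl⟩ := hlτ hTf hTτ0 sPv sTτ uPv uTτ hz1
  obtain ⟨e3, c3, hc3, he3, T3l⟩ := hl3 hTf hT30 sT3 s1L uT3 u1L hz1
  have he30 : e3 = 0 := he3 (by norm_num)
  rw [he30] at T3l
  simp only [pow_zero, one_mul] at T3l
  /- ## 8. The identity (✦) along `s = 1 + t` -/
  have hre : ∀ t : ℝ, 0 < t → 1 < (1 + (t : ℂ)).re := fun t ht => by simp; linarith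
  obtain ⟨-, -, -, -, LI5, LI6⟩ := stub_localIdentities
  have hαcard : ∀ v ∉ S, Multiset.card (α v) = 4 ∧ ∀ a ∈ α v, a ≠ 0 := fun v hv => ⟨cα v hv, nzα v hv⟩
  have hMF : ∀ v ∉ S, _ := fun v hv =>
    kc_matching_families hdeg hτ huP sB hv (hunr v hv) ((hK v hv).2.2.1 (α v) (sα v hv))
  have hsplitF : ∀ v ∉ S, ∀ w : HeightOneSpectrum (𝓞 L), w.under (𝓞 K) = v → w.asIdeal.inertiaDeg (𝓞 K) = 1 → wedgeTwoParams (α v) = B w + B (τ • w) := fun v hv => (hMF v hv).1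
  have hinertF : ∀ v ∉ S, ∀ w : HeightOneSpectrum (𝓞 L), w.under (𝓞 K) = v → w.asIdeal.inertiaDeg (𝓞 K) = 2 → ∃ γ : Multiset ℂ, Multiset.card γ = 3 ∧ γ.map (· ^ 2) = B w ∧ wedgeTwoParams (α v) = γ + γ.map (-·) :=
    fun v hv => (hMF v hv).2
  have hId : ∀ t : ℝ, 0 < t → partialPairL S α fT1 (1 + t) * partialPairL S αv fT2 (1 + t) = partialPairL T fξ oneL1 (1 + t) * partialPairL T fPv fTτ (1 + t) * (partialPairL T fT3 oneL1 (1 + t)) ^ 2 := by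
    intro t ht
    exact kleinHelper_identityStar K L hdeg τ hτ LI5 LI6 S α B cK (fun w => ωL.valueAtUniformizer w)
      (fun w => Ω.valueAtUniformizer w) (fun w => cL.valueAtUniformizer w) hunr hαcard cB hωLw hΩw hcLw
      hsplitF hinertF (1 + t)
      (hm1 hSf hM1 sα sT1 uα uT1 (hre t ht)) (hm2 hSf hM2 sαv sT2 uαv uT2 (hre t ht))
      (hm3 hTf hM3 sξ s1L uξ u1L (hre t ht)) (hm4 hTf hM4 sPv sTτ uPv uTτ (hre t ht))
      (hm5 hTf hM5 sT3 s1L uT3 u1L (hre t ht))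
  /- ## 9. Pole counting -/
  obtain ⟨-, -, PC3⟩ := kleinHelper_poleCounting
  exact PC3 (fun t => partialPairL S α fT1 (1 + t)) (fun t => partialPairL S αv fT2 (1 + t))
    (fun t => partialPairL T fξ oneL1 (1 + t)) (fun t => partialPairL T fPv fTτ (1 + t))
    (fun t => partialPairL T fT3 oneL1 (1 + t)) ca cb cξ cτ c3 eτ hcξ hcτ hc3 Ta Tb Tξ Tτl T3l hId

end Summit.Langlands.Langlands.Theorems.InducedSquareAscentKleinCube

end
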